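import Summits.Ventures.QEC.Census.CertInfoSetOrbitStabSound
import HarnessLib

/-!
# Orbit-STABILIZED information sets — certificate-level statements (qec-search-4 g6; companion of
# `Census/CertInfoSetOrbitStab.lean` / `Census/CertInfoSetOrbitStabSound.lean`)

The shapes an emitted census row proves, all with conclusions LITERALLY the landed hypotheses of qec-type-10's
`DistCert.isCode_of_onesided_lower` / qec-type-02's `CSSCode.dZ_eq_of_witness`:
* producer wrappers `DistCert.maskCoversZ_of_stab` / `maskCoversX_of_stab` (a stabilized view's canonical families ⇒
  `MaskCovers`) and `DistCert.maskCoversZ_of_reaches` / `maskCoversX_of_reaches` (a plain view's replay ⇒ `MaskCovers`);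
* `DistCert.lowZ_of_orbitM` / `lowX_of_orbitM` / `dZ_code_of_orbitM` / `dX_code_of_orbitM` (generator/word checks +
  the masked profile check + `MaskCovers` per view ⇒ the flat lower bound / the exact sector distance);
* the `[[4,2,2]]` end-to-end control through ONE stabilized view.
HONEST FRAMING: no certificate is read and no distance is asserted here; tier KERNEL, axioms ⊆ {propext, Classical.choice,
Quot.sound}; no `native_decide`. [folklore]
-/

set_option autoImplicit false

namespace Summit.Ventures.QEC.Census

open Matrix Literature.InformationTheory.QuantumCodes

/-! ## 4a. Glue for emitted rows -/

/-- The rows of a canonical family and its forced row are words below `2^n` (the `hG` hypothesis of qec-type-01's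
`Plane.topReaches_of_seg[2]`), from the RREF certificate check and `base[j] < n`. -/
theorem StabView.canonRows_lt (v : StabView) {n : ℕ} {Hsyn : List ℕ} (hI : infoSetStructOK n Hsyn v.ic = true)
    (j : ℕ) (hb : v.base.getD j 0 < n) : ∀ x ∈ v.canonRows n j ++ [v.baseRow j], x < 2 ^ n := by
  have hI' := hI
  simp only [infoSetStructOK, Bool.and_eq_true] at hI'
  intro x hx
  rcases List.mem_append.1 hx with h | h
  · obtain ⟨y, hy, rfl⟩ := List.mem_map.1 h
    exact kerVec_lt_two_pow hI'.1 (v.mem_canonCols.1 hy).1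
  · rw [List.mem_singleton] at h
    subst h
    exact kerVec_lt_two_pow hI'.1 hb

/-! ## 4. The certificate-level statements -/

namespace DistCert

variable (c : DistCert)

/-- `Z` side: a stabilized view's families discharge its `MaskCovers` (fast generator check). (theorem) -/
theorem maskCoversZ_of_stab (hs : c.checkStructure = true) {gens : List AutGen}
    (hgens : autGensOKFast c.n c.HX c.HZ gens = true) (v : StabView) (hI : infoSetStructOK c.n c.HX v.ic = true)
    (hv : v.stabOK c.n (autPerms gens) gens.length = true)
    (hfam : 0 < v.t → ∀ j, j < v.norb →
      TopReaches (bzLeaf (c.dZ - 1) (c.sideZ.found.map Prod.fst)) (v.canonRows c.n j) (v.baseRow j) (v.t - 1)) :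
    MaskCovers c.n c.HX c.HZ (c.dZ - 1) v.mask v.t := by
  have h' := hs
  simp only [checkStructure, Bool.and_eq_true] at h'
  exact maskCovers_of_stab (comm_of_commOK (c.commOK_of_checkStructure hs)) h'.1.1.2 (autGensOK_of_fast hgens) v hI
    hv hfam

/-- `X` side: a stabilized view's families discharge its `MaskCovers` (roles of `H^X`, `H^Z` exchanged). (theorem) -/
theorem maskCoversX_of_stab (hs : c.checkStructure = true) {gens : List AutGen}
    (hgens : autGensOKFast c.n c.HZ c.HX gens = true) (v : StabView) (hI : infoSetStructOK c.n c.HZ v.ic = true)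
    (hv : v.stabOK c.n (autPerms gens) gens.length = true)
    (hfam : 0 < v.t → ∀ j, j < v.norb →
      TopReaches (bzLeaf (c.dX - 1) (c.sideX.found.map Prod.fst)) (v.canonRows c.n j) (v.baseRow j) (v.t - 1)) :
    MaskCovers c.n c.HZ c.HX (c.dX - 1) v.mask v.t := by
  have h' := hs
  simp only [checkStructure, Bool.and_eq_true] at h'
  have hcomm := comm_of_commOK (c.commOK_of_checkStructure hs)
  have hcomm' : rowMatrix c.n c.HZ * (rowMatrix c.n c.HX)ᵀ = 0 := by
    rw [← Matrix.transpose_transpose (rowMatrix c.n c.HZ), ← Matrix.transpose_mul, hcomm, Matrix.transpose_zero]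
  exact maskCovers_of_stab hcomm' h'.2 (autGensOK_of_fast hgens) v hI hv hfam

/-- `Z` side: a plain view's replay discharges its `MaskCovers` for the free mask. (theorem) -/
theorem maskCoversZ_of_reaches (hs : c.checkStructure = true) (V : OrbitView)
    (hI : infoSetStructOK c.n c.HX V.ic = true)
    (hreach : Reaches (bzLeaf (c.dZ - 1) (c.sideZ.found.map Prod.fst)) (rowPos (kerBasis c.n V.ic.piv V.ic.red) 0)
      V.t 0 0) :
    MaskCovers c.n c.HX c.HZ (c.dZ - 1) (freeMaskOf c.n V.ic.piv) V.t := by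
  have h' := hs
  simp only [checkStructure, Bool.and_eq_true] at h'
  exact maskCovers_of_reaches h'.1.1.2 V hI hreach

/-- `X` side: a plain view's replay discharges its `MaskCovers` for the free mask. (theorem) -/
theorem maskCoversX_of_reaches (hs : c.checkStructure = true) (V : OrbitView)
    (hI : infoSetStructOK c.n c.HZ V.ic = true)
    (hreach : Reaches (bzLeaf (c.dX - 1) (c.sideX.found.map Prod.fst)) (rowPos (kerBasis c.n V.ic.piv V.ic.red) 0)
      V.t 0 0) :
    MaskCovers c.n c.HZ c.HX (c.dX - 1) (freeMaskOf c.n V.ic.piv) V.t := by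
  have h' := hs
  simp only [checkStructure, Bool.and_eq_true] at h'
  exact maskCovers_of_reaches h'.2 V hI hreach

/-- **`Z`-side lower bound from the masked / stabilized lane** (the `lowZ` hypothesis of `isCode_of_onesided_lower`). -/
theorem lowZ_of_orbitM (hs : c.checkStructure = true) {gens : List AutGen}
    (hgens : autGensOKFast c.n c.HX c.HZ gens = true) {words : List (List ℕ)}
    (hwords : autWordsOK gens.length words = true) (views : List OrbitView) (masks : List ℕ)
    (hcov : ∀ s, s < views.length → MaskCovers c.n c.HX c.HZ (c.dZ - 1) (masks.getD s 0) (views.getD s dfltView).t)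
    {cls : List ℕ} {μ : List (List ℕ)}
    (hprof : orbitProfileOKM c.n (c.dZ - 1) (autPerms gens) words masks views cls μ = true) :
    ∀ w : Fin c.n → ZMod 2, rowMatrix c.n c.HX *ᵥ w = 0 → w ∉ rowSpace (rowMatrix c.n c.HZ) →
      c.dZ - 1 < hammingNorm w :=
  orbit_lower_soundM (comm_of_commOK (c.commOK_of_checkStructure hs)) hgens hwords hcov hprof

/-- **`X`-side lower bound from the masked / stabilized lane.** -/
theorem lowX_of_orbitM (hs : c.checkStructure = true) {gens : List AutGen}
    (hgens : autGensOKFast c.n c.HZ c.HX gens = true) {words : List (List ℕ)}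
    (hwords : autWordsOK gens.length words = true) (views : List OrbitView) (masks : List ℕ)
    (hcov : ∀ s, s < views.length → MaskCovers c.n c.HZ c.HX (c.dX - 1) (masks.getD s 0) (views.getD s dfltView).t)
    {cls : List ℕ} {μ : List (List ℕ)}
    (hprof : orbitProfileOKM c.n (c.dX - 1) (autPerms gens) words masks views cls μ = true) :
    ∀ w : Fin c.n → ZMod 2, rowMatrix c.n c.HZ *ᵥ w = 0 → w ∉ rowSpace (rowMatrix c.n c.HX) →
      c.dX - 1 < hammingNorm w := by
  have hcomm := comm_of_commOK (c.commOK_of_checkStructure hs)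
  have hcomm' : rowMatrix c.n c.HZ * (rowMatrix c.n c.HX)ᵀ = 0 := by
    rw [← Matrix.transpose_transpose (rowMatrix c.n c.HZ), ← Matrix.transpose_mul, hcomm, Matrix.transpose_zero]
  exact orbit_lower_soundM hcomm' hgens hwords hcov hprof

/-- **`d_Z` from the masked / stabilized lane** (upper: the certificate's weight-`dZ` witness). -/
theorem dZ_code_of_orbitM (hs : c.checkStructure = true) {gens : List AutGen}
    (hgens : autGensOKFast c.n c.HX c.HZ gens = true) {words : List (List ℕ)}
    (hwords : autWordsOK gens.length words = true) (views : List OrbitView) (masks : List ℕ)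
    (hcov : ∀ s, s < views.length → MaskCovers c.n c.HX c.HZ (c.dZ - 1) (masks.getD s 0) (views.getD s dfltView).t)
    {cls : List ℕ} {μ : List (List ℕ)}
    (hprof : orbitProfileOKM c.n (c.dZ - 1) (autPerms gens) words masks views cls μ = true) (hd : 1 ≤ c.dZ) :
    (c.code (c.commOK_of_checkStructure hs)).dZ = c.dZ := by
  have h' := hs
  simp only [checkStructure, Bool.and_eq_true] at h'
  obtain ⟨hv, hv', hwt⟩ := upper_sound h'.1.1.1.2
  refine (c.code _).dZ_eq_of_witness hv hv' hwt fun w hw hw' => ?_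
  have := c.lowZ_of_orbitM hs hgens hwords views masks hcov hprof w hw hw'
  omega

/-- **`d_X` from the masked / stabilized lane.** -/
theorem dX_code_of_orbitM (hs : c.checkStructure = true) {gens : List AutGen}
    (hgens : autGensOKFast c.n c.HZ c.HX gens = true) {words : List (List ℕ)}
    (hwords : autWordsOK gens.length words = true) (views : List OrbitView) (masks : List ℕ)
    (hcov : ∀ s, s < views.length → MaskCovers c.n c.HZ c.HX (c.dX - 1) (masks.getD s 0) (views.getD s dfltView).t)
    {cls : List ℕ} {μ : List (List ℕ)}
    (hprof : orbitProfileOKM c.n (c.dX - 1) (autPerms gens) words masks views cls μ = true) (hd : 1 ≤ c.dX) :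
    (c.code (c.commOK_of_checkStructure hs)).dX = c.dX := by
  have h' := hs
  simp only [checkStructure, Bool.and_eq_true] at h'
  obtain ⟨hv, hv', hwt⟩ := upper_sound h'.1.2
  refine (c.code _).dX_eq_of_witness hv hv' hwt fun w hw hw' => ?_
  have := c.lowX_of_orbitM hs hgens hwords views masks hcov hprof w hw hw'
  omega

end DistCert

/-! ## 5. End-to-end control (`[[4,2,2]]` of `Census/CertCheck.lean` through the stabilized lane) -/

/-- **Control (producer)**: the stabilized view `stabC422` (subgroup `{id, q ↦ q+2}`, two canonical families) covers its
column set for the `[[4,2,2]]` certificate — structural checks and both forced-top-row families by `decide`. -/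
theorem maskCovers_certC422_stab :
    MaskCovers certC422.n certC422.HX certC422.HZ (certC422.dZ - 1) stabC422.mask stabC422.t :=
  certC422.maskCoversZ_of_stab checkStructure_certC422 (gens := [⟨[1, 2, 3, 0], [0], [0]⟩]) (by decide)
    stabC422 (by decide) (by decide) fun _ j hj => by
      have hj2 : j < 2 := hj
      interval_cases j
      · exact Plane.topReaches_of_seg 4 1 [] _ _ 0 1 (by decide) (by decide)
      · exact Plane.topReaches_of_seg 4 1 [] _ _ 0 1 (by decide) (by decide)

/-- **Control (end to end)**: every non-trivial `Z`-logical of the `[[4,2,2]]` certificate has weight `> 1` via ONE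
stabilized view, the masked profile check and `lowZ_of_orbitM` — the statement is the landed `lowZ_certC422_orbit`, so
this is an `example` (no restatement). -/
example : ∀ w : Fin certC422.n → ZMod 2, rowMatrix certC422.n certC422.HX *ᵥ w = 0 →
    w ∉ rowSpace (rowMatrix certC422.n certC422.HZ) → certC422.dZ - 1 < hammingNorm w :=
  certC422.lowZ_of_orbitM checkStructure_certC422 (gens := [⟨[1, 2, 3, 0], [0], [0]⟩]) (by decide)
    (words := [[], [0], [0, 0], [0, 0, 0]]) (by decide) [stabC422.toView] [15]
    (by
      intro s hs
      have hs0 : s = 0 := by simp [StabView.toView] at hs; omega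
      subst hs0
      exact maskCovers_certC422_stab)
    (cls := [0, 0, 0, 0]) (μ := [[4]]) (by decide)

end Summit.Ventures.QEC.Census
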